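import Literature.Probability.RandomPlanarGeometry.ChordalLERWScalingLimit
import Literature.Probability.LatticeModels.RandomWalkLoopDeterminant
import HarnessLib

/-!
# Chordal LERW ⟶ SLE₂ (Lawler–Viklund 2021): proofs, part 0 — the discrete set-up is sane

Topic `Probability/RandomPlanarGeometry`; namespace
`Literature.Probability.RandomPlanarGeometry.ChordalLERW`. Theorems only (no definition, no named
fact): the first, elementary layer of the proof programme for the named fact
`ChordalLERW.lawlerViklund_tendsto_sle_two` (`ChordalLERWScalingLimit.lean`), i.e. of
[LawlerViklund2021] §2.3, Theorem "main_complete" forgetting the parametrisation. This layer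
makes the standing finiteness assertions of [LawlerViklund2021] §2.1 ("`A` is a finite subset of
`ℤ²`", "the total measure of `𝒦_A(z,w)` equals `G_A(z,w)`", "`P_{A,a,b} = P̂_{A,a,b}/H_{∂A}(a,b)`
… the probability law of LERW") hold for the discretisation `A_{N,D}` of a bounded domain:

* `squareSites_finite`, `approxSites_finite` — for bounded `D`, `{ζ : 𝒮_ζ ⊂ ND}` and `A_{N,D}` are
  finite;
* `reachable_siteGraph_approxSites` — `A_{N,D}` is connected through nearest-neighbour edges
  (it is the component of the origin), so any two of its sites are joined by a walk of
  `siteGraph A_{N,D}`;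
* `rwGreen_siteGraph_ne_top` (finite `A`), `rwGreen_siteGraph_ne_zero` (reachable endpoints) —
  `0 < G_A(z,w) < ∞`, the finiteness being the tree's `rwGreen_ne_top` (transience of the killed
  walk, `RandomWalkLoopDeterminant.lean`);
* `isProbabilityMeasure_law_approxSites` — hence `P^N_{A_N,a_N,b_N}` (`ChordalLERW.law`) is a
  probability measure for boundary edges `a_N, b_N` of `A_N = A_{N,D}`, `D` bounded, and
  `eventually_isProbabilityMeasure_law` — eventually so under the hypotheses of the fact.

## References

* G. F. Lawler, F. Viklund, Duke Math. J. 170 (2021), §2.1 (p. 7 of arXiv:1603.05203), §2.3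
  (p. 9) [LawlerViklund2021].
* G. F. Lawler, *Topics in loop measures and the loop-erased walk*, Probab. Surveys 15 (2018), §2
  (integrable weights; `G = (I - Q)⁻¹`) [Lawler2018].
-/

noncomputable section

open MeasureTheory Filter Set
open _root_.Topology
open scoped ENNReal NNReal Classical
open Literature.Probability.LatticeModels

namespace Literature.Probability.RandomPlanarGeometry

namespace ChordalLERW

/-! ### Finiteness of the discretisation -/

/-- The centre `ζ` of the square `𝒮_ζ` belongs to it. [folklore] -/
theorem toComplex_mem_unitSquare (ζ : Site 2) : Site.toComplex ζ ∈ unitSquare ζ := by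
  simp [unitSquare, Site.toComplex]

/-- The lattice points of `ℤ²` with both coordinates in `[-M, M]` form a finite set. [folklore] -/
theorem finite_setOf_coord_mem_Icc (M : ℤ) :
    {ζ : Site 2 | ∀ i, ζ i ∈ Icc (-M) M}.Finite := by
  refine (Set.finite_Icc (fun _ : Fin 2 => -M) (fun _ : Fin 2 => M)).subset ?_
  intro ζ hζ
  exact ⟨fun i => (hζ i).1, fun i => (hζ i).2⟩

/-- **`{ζ ∈ ℤ² : 𝒮_ζ ⊂ ND}` is finite for a bounded `D`** ([LawlerViklund2021] §2.1: "`A` is a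
finite subset of `ℤ²`"): the centre of each such square lies in the bounded set `ND`.
[cite: LawlerViklund2021, §2.1] -/
theorem squareSites_finite (N : ℝ) {D : Set ℂ} (hD : Bornology.IsBounded D) :
    (squareSites N D).Finite := by
  obtain ⟨R, hR⟩ := hD.exists_norm_le
  refine (finite_setOf_coord_mem_Icc ⌈|N| * |R|⌉).subset ?_
  intro ζ hζ
  obtain ⟨w, hw, hwζ⟩ := hζ (toComplex_mem_unitSquare ζ)
  have hnorm : ‖Site.toComplex ζ‖ ≤ |N| * |R| := by
    rw [← hwζ, norm_mul, Complex.norm_real, Real.norm_eq_abs]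
    exact mul_le_mul_of_nonneg_left ((hR w hw).trans (le_abs_self R)) (abs_nonneg N)
  have hcoord : ∀ i, |((ζ i : ℤ) : ℝ)| ≤ |N| * |R| := by
    intro i
    fin_cases i
    · exact (Complex.abs_re_le_norm _).trans hnorm
    · exact (Complex.abs_im_le_norm _).trans hnorm
  intro i
  have h1 := hcoord i
  have h2 : (|N| * |R| : ℝ) ≤ (⌈|N| * |R|⌉ : ℤ) := Int.le_ceil _
  rw [abs_le] at h1
  constructor
  · have : (-(⌈|N| * |R|⌉ : ℤ) : ℝ) ≤ (ζ i : ℝ) := by linarith [h1.1]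
    exact_mod_cast this
  · have : ((ζ i : ℤ) : ℝ) ≤ (⌈|N| * |R|⌉ : ℤ) := h1.2.trans h2
    exact_mod_cast this

/-- **`A_{N,D}` is finite for a bounded `D`** ([LawlerViklund2021] §2.1, §2.3).
[cite: LawlerViklund2021, §2.3] -/
theorem approxSites_finite (N : ℝ) {D : Set ℂ} (hD : Bornology.IsBounded D) :
    (approxSites N D).Finite :=
  (squareSites_finite N hD).subset (approxSites_subset_squareSites N D)

/-! ### `A_{N,D}` is connected -/

/-- Every site of `A_{N,D}` is joined to the origin by a walk of `siteGraph A_{N,D}` (the chain of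
squares inside `ND` defining the component of the origin stays inside that component).
[cite: LawlerViklund2021, §2.3] -/
theorem reachable_zero_siteGraph_approxSites {N : ℝ} {D : Set ℂ} {x : Site 2}
    (hx : x ∈ approxSites N D) : (siteGraph (approxSites N D)).Reachable 0 x := by
  obtain ⟨-, hx⟩ := hx
  induction hx with
  | refl => exact SimpleGraph.Reachable.refl _
  | tail huv hR ih =>
    rename_i u v
    obtain ⟨hadj, hu, hv⟩ := hR
    have hu' : u ∈ approxSites N D := ⟨hu, huv⟩
    have hv' : v ∈ approxSites N D := ⟨hv, huv.tail ⟨hadj, hu, hv⟩⟩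
    exact ih.trans (SimpleGraph.Adj.reachable (siteGraph_adj_iff.2 ⟨hadj, hu', hv'⟩))

/-- **`A_{N,D}` is connected**: any two of its sites are joined by a nearest-neighbour walk
staying in `A_{N,D}` ("the connected component containing the origin", [LawlerViklund2021]
§2.3). [cite: LawlerViklund2021, §2.3] -/
theorem reachable_siteGraph_approxSites {N : ℝ} {D : Set ℂ} {x y : Site 2}
    (hx : x ∈ approxSites N D) (hy : y ∈ approxSites N D) :
    (siteGraph (approxSites N D)).Reachable x y :=
  (reachable_zero_siteGraph_approxSites hx).symm.trans (reachable_zero_siteGraph_approxSites hy)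

/-! ### The Green's function `G_A(z, w)` is positive and finite -/

/-- **`G_A(z,w) < ∞` for finite `A`** (transience of the simple random walk killed off the finite
set `A`; [LawlerViklund2021] §2.1 "the total measure of `𝒦_A(z,w)` equals `G_A(z,w)`", Lawler
2018 §2 `G = (I - Q)⁻¹`), from the tree's `rwGreen_ne_top`. [cite: Lawler2018, §2] -/
theorem rwGreen_siteGraph_ne_top {A : Set (Site 2)} (hA : A.Finite) {z w : Site 2} (hz : z ∈ A)
    (hw : w ∈ A) : rwGreen (siteGraph A) z w ≠ ⊤ := by
  have hV : ∀ x y : Site 2, (siteGraph A).Adj x y → x ∈ hA.toFinset := fun x y h =>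
    hA.mem_toFinset.2 (siteGraph_adj_iff.1 h).2.1
  exact rwGreen_ne_top (siteGraph_le_zdGraph A) hV ⟨z, hA.mem_toFinset.2 hz⟩
    ⟨w, hA.mem_toFinset.2 hw⟩

/-- **`G_A(z,w) > 0` as soon as `w` can be reached from `z` inside `A`**: one walk `ω` already
contributes `4^{-|ω|} > 0`. [folklore] -/
theorem rwGreen_ne_zero_of_reachable {G : SimpleGraph (Site 2)} {z w : Site 2}
    (h : G.Reachable z w) : rwGreen G z w ≠ 0 := by
  obtain ⟨ω⟩ := h
  refine ne_of_gt (lt_of_lt_of_le ?_ (ENNReal.le_tsum ω))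
  exact ENNReal.pow_pos (by norm_num) _

/-- `G_{A_{N,D}}(z, w) > 0` for sites `z, w ∈ A_{N,D}`. [cite: LawlerViklund2021, §2.1] -/
theorem rwGreen_siteGraph_approxSites_ne_zero {N : ℝ} {D : Set ℂ} {z w : Site 2}
    (hz : z ∈ approxSites N D) (hw : w ∈ approxSites N D) :
    rwGreen (siteGraph (approxSites N D)) z w ≠ 0 :=
  rwGreen_ne_zero_of_reachable (reachable_siteGraph_approxSites hz hw)

/-! ### `P^N_{A_N, a_N, b_N}` is a probability measure -/

/-- **The scaled chordal LERW law is a probability measure** ([LawlerViklund2021] §2.1: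
"`P_{A,a,b}` … is the probability law of loop-erased random walk (LERW) in `A` from `a` to `b`"):
for a bounded `D` and boundary edges `a, b ∈ ∂ₑA_{N,D}`, `ChordalLERW.law N A_{N,D} a b` has total
mass one (`0 < G_A(a₊,b₊) < ∞`). [cite: LawlerViklund2021, §2.1] -/
theorem isProbabilityMeasure_law_approxSites {N : ℝ} {D : Set ℂ} (hD : Bornology.IsBounded D)
    {a b : Site 2 × Site 2} (ha : IsBoundaryEdge (approxSites N D) a)
    (hb : IsBoundaryEdge (approxSites N D) b) :
    IsProbabilityMeasure (law N (approxSites N D) a b) :=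
  isProbabilityMeasure_law (rwGreen_siteGraph_approxSites_ne_zero ha.2.2 hb.2.2)
    (rwGreen_siteGraph_ne_top (approxSites_finite N hD) ha.2.2 hb.2.2)

/-- Under the hypotheses of `lawlerViklund_tendsto_sle_two` (a Dobrushin domain `D`, hence
bounded, and eventually boundary edges `a_N, b_N` of `A_{N,D}`), the laws `P^N_{A_N,a_N,b_N}` are
eventually probability measures — the reading "for each `N`" = "for all large `N`" of the
vendored statement. [cite: LawlerViklund2021, §2.3] -/
theorem eventually_isProbabilityMeasure_law (D : DobrushinDomain) (a b : ℕ → Site 2 × Site 2)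
    (hab : ∀ᶠ N : ℕ in atTop, IsBoundaryEdge (approxSites N D.carrier) (a N) ∧
      IsBoundaryEdge (approxSites N D.carrier) (b N) ∧ (a N).1 ≠ (b N).1) :
    ∀ᶠ N : ℕ in atTop,
      IsProbabilityMeasure (law N (approxSites N D.carrier) (a N) (b N)) := by
  filter_upwards [hab] with N hN
  exact isProbabilityMeasure_law_approxSites D.isBounded hN.1 hN.2.1

end ChordalLERW

end Literature.Probability.RandomPlanarGeometry
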